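import Mathlib
import HarnessLib
import HarnessLib.Audit
import Summits.Langlands.Statement
import Literature.FieldTheory.AlgClosed.PadicAlgClEquivComplex
import Literature.NumberTheory.PAdicHodge.FontaineDpst
import Literature.NumberTheory.Automorphic.LocalLanglandsGLProofs
import Literature.NumberTheory.Automorphic.LocalConstantsProofs
import Summits.Langlands.Langlands.Theorems.EisensteinDegreeShiftSectorComplementStubAvatarConjugacy
import HarnessLib.Audit.Status.Attr

/-!
Route: LieTypeCarving

# Route LieTypeCarving — Root decomposition of GL(n) reciprocity — the geometric-automorphy residual
carved by the Lie type of the algebraic monodromy group (Artin–Hecke | Lie-isotypic |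
Lie-imprimitive) along the solvable-image barrier

Decomposition node of the Langlands root ladder (cell decomp-langlands, lens-6 «barrier-complement
carving», gen 2, RESIDUAL MODE): the blocker B_w = PrimeSwitchSplit.WeakGeometricAutomorphy
(stmt-Langlands-17414, crux r2 of RootDecomp1) is cut EXACTLY (kernel `B_w ↔ C₁ ∧ C₂ ∧ C₃` by
excluded middle at each rank inside a strong induction on the rank, 0 EQUIV) by the LIE TYPE of the
algebraic monodromy group G of ρ read on the derived group of G°: C₁ ArtinHeckeAutomorphy (ρ
POTENTIALLY ABELIAN: some open subgroup has commutative image ⟺ G° a torus), C₂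
LieIsotypicAutomorphy (not PA, V|(G°)^der isotypic — typed by derived commutants of ρ(⁅H,H⁆) on
small open H), C₃ LieImprimitiveTransport (V|(G°)^der not isotypic = genuinely induced from the
stabiliser field K₁ of a derived type; TRANSPORT form: given B_w at every rank < n over every field
— which covers the constituent ρ₁ — prove weak automorphy of ρ, i.e. the induction step K₁ → K). The
cut is carved along B3 =
Literature.Barriers.Langlands.SolvableImageBarrier(/Narrow/NarrowInduction): C₂ lies by construction
OUTSIDE B3 (no finite layer makes ρ solvable-image), C₁ is B3's Artin cell, C₃ is B3's
NarrowInduction core in ℓ-adic form; every cell and its complement is invariant under twists by all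
characters and restriction to / descent from every finite extension (kernel theorems in the node
file); automorphic induction preserves the C₁ boundary and raises C₂-data over K₁ into C₃ over K
only from lower rank, which is C₃'s hypothesis (critic 02:53:07Z, fix F1). It suffices to show X =
C₁ ∧ C₂ ∧ C₃ ∧ W⁺ ∧ P ∧ L∤R ∧ CRD (U = AvatarConjugacy proved).
WHY THIS IS NOVEL: the first filed axis that CARVES B_w ALONG A CATALOGUED BARRIER — the Lie type of
(G°)^der puts the whole quantifier range of `Literature.Barriers.Langlands.SolvableImageBarrier`
(+Narrow, +NarrowInduction) into C₁ ∪ C₃ and makes C₂ (Lie-isotypic, ¬potentially-abelian)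
barrier-free BY CONSTRUCTION (restriction-invariant: no finite layer has solvable image; kernel
`isLieIsotypic_restrictField_iff`, `isPotentiallyAbelian_restrictField_iff` for EVERY finite L/K) —
no other node or route of the Langlands Theses types potential abelianity / Lie-isotypy of ρ;
dictionary to the sibling MonodromyDichotomy (OR-6) recorded by the lens: S1 ⊆ C₁, G ⊆ C₂, C₃ ⊆
induced-from-lower-rank, and C₂∖G, C₃ refine S2′ WITHOUT the lower-rank hypothesis (so the two
partitions are NOT equivalent item-by-item: no dedup, genuinely different cells). LINEAGE: NODE
decomp-langlands-lens-6-g2 2026-08-30T02:47:14Z (HOME/STATUS.md L91), filing kit NOTE 02:51:54Z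
(L98), crit-1 OBJECTION 02:53:07Z (L100: C₃'s boundary not closed under cyclic AI) answered by NODE
v2 03:05:34Z (L106: F1 adopted — C₃ := LieImprimitiveTransport with the lower-rank hypothesis,
exactness by strong induction on rank; kit v2 natively certified: conclusion Langlands · binder_used
7/7 · in-cone 8/8 · codes ∅ · axioms std; KitCheck Iff.rfl 5/5), CLEARED by decomp-langlands crit-1
CLEARED 2026-08-30T03:07:14Z (HOME/STATUS.md L108; HOME/CRITIC-LEDGER.md row 26); filed by the
cell's route-writer decomp-langlands-writer-1 (gen 2) as ROOT-level sibling #7 (alternative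
decompositions of B_w = separate routes sharing N0's items by dedup, D-0019; BC1 cone = 7 = N0's
four cores + B_w cut in three: ONE thesis — the Lie-type trichotomy of one item). Census instrument
of record: HOME/census/COSTUME-CENSUS-v3.md sha256
9ead1a80e4f5c5db3cfd0730ede724ac08f810f0499968a92de4dd9bfb814d6d (json ec67c7c6…; v2 92d1557a…): the
HC1 box (ℚ, n = 2, even icosahedral) lies in C₁ ONLY. Rung currency: rung 0.
Lean: `ArtinHeckeAutomorphy ∧ LieIsotypicAutomorphy ∧ LieImprimitiveTransport ∧
SatakeAvatarExistence ∧ PadicMemberCompatibility ∧ CompatibilityAwayFromLR ∧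
CanonicalReciprocityData`

Rationale: WHY THIS LINE. Every residual of B_w filed so far is cut by a REGIME (weights, field, ρ̄, ℓ, local
shape) and the critic's orbit-closure rule (census G2) showed regimes leak under the print transfer
groupoid (twists, solvable base change/descent). The one datum of ρ that the groupoid cannot move is
the Lie algebra of its algebraic monodromy group modulo its centre: potentially-abelian tensor
factors, twists and finite restrictions change only the torus and the component group. Cutting B_w
by (G°)^der-isotypy type therefore gives three cells over intrinsic classes — C₁ and C₂ standalone
reciprocity conjectures, C₃ a transport statement handed B_w at lower rank (automorphic induction,
the one groupoid generator that changes (K, n), raises Lie-isotypic data into C₃ only from lower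
rank) — with no cross-terms modulo print: C₁ = strong Artin ∪ Hecke (the
Langlands–Tunnell/Khare–Wintenberger/Booker world; barrier SolvableImage, instrument certified Maass
censuses), C₂ = the patching world (Kisin/BLGGT/ten authors/Pan; outside SolvableImage by
construction; barriers NonRegularWeight, ShimuraVarietyRealization, TaylorWilesNumericalCoincidence,
ResiduallyReducible, TwistedEndoscopySelfDual placed), C₃ = the functoriality world (automorphic
induction along insoluble layers = SolvableImageBarrierNarrowInduction's named core). Imported area:
structure theory of ℓ-adic monodromy groups (Serre, Larsen–Pink 1992, Katz's Lie-irreducibility,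
Patrikis 2012 §4.1, Hui 2023). What prior routes do not do: MonodromyDichotomy (lens-2-g2) cuts by
Clifford–Tate structure with a transport crux carrying a lower-rank hypothesis; PrimitiveRankLadder
cuts by self-twists at fixed rank; here the boundary is (G°)^der-isotypy — C₁ ⊋ R1 ∪ S1, C₂ ⊋ G
(Lie-irreducible ⊗ potentially-abelian data stay in C₂ unconditionally), C₃ ⊊ the induced class —
exhaustive by excluded middle with no print structure item, with kernel-certified twist/restriction
invariance.
RANKED CRUXES. rank 2 ArtinHeckeAutomorphy (C₁: contains the census's first open box HC1 — even
icosahedral Artin over ℚ — and every insoluble finite image); 3 LieIsotypicAutomorphy (C₂: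
Fontaine–Mazur–Langlands for big-monodromy ρ over arbitrary K); 4 LieImprimitiveTransport (C₃:
automorphic induction of Lie-isotypic data given B_w at lower rank — insoluble layers open); 5
SatakeAvatarExistence (W⁺, 17415); 6 PadicMemberCompatibility (P, 17534); 7 CompatibilityAwayFromLR
(L∤R, 18084); support CanonicalReciprocityData (17930); Assembly.
KILL CRITERIA. A refutation of any cell refutes B_w and hence GlobalLanglandsCorrespondenceGLn as
stated (each cell is a literal restriction of B_w: kernel artinHecke_of_weak / lieIsotypic_of_weak /
lieImprimitiveTransport_of_weak); a proof that some cell implies B_w outright (insoluble descent or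
functorial division in print) collapses the carving to COSTUME and retires the route as a
decomposition (not the statements).
NOT DECOMPOSED YET. C₃ ⟸ AI_w^der (Galois-side automorphic induction of weakly automorphic
Lie-isotypic data from the stabiliser field of a derived type; print sub-solvable, open insoluble)
given the PRINT Clifford support «ρ ∈ C₃ ⇒ ρ ≅ Ind ρ₁, [K₁:K] ≥ 2, ρ₁ Lie-isotypic» over the tree's
FramedRep.induce; C₂ ⟸ Lie-irreducible ∧ (Lie-irreducible ⊗ primitive projective-Artin, m ≥ 2); C₁ ⟸
projectively-finite (Artin ⊗ χ) ∧ CM-type; C₂ along TwistedEndoscopySelfDual (W ≅ W^∨ vs not) — all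
groupoid-invariant, none typed at open.
CHEAPEST FALSIFIER. Instantiate the three cells at n = 1 (C₁ = class field theory + Weil, kernel
isPotentiallyAbelian_of_rank_one; C₂, C₃ vacuous at n = 1 since every character is potentially
abelian — kernel isLieIsotypic_of_isPotentiallyAbelian) and at n = 2 over ℚ (C₁ = strong Artin for
GL₂/ℚ: odd known, even icosahedral open; C₂ = Fontaine–Mazur for GL₂/ℚ: odd known up to the
dyadic/small-image provisos, even regular void by Calegari; C₃ vacuous for n ≤ 3 — a Lie-imprimitive
irreducible ρ has rank [K₁:K]·m with m ≥ 2 —, print mod its hypothesis for n < 10, first open box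
(ℚ, 10, Ind from an S₅-quintic of ρ_{E,ℓ})) — consistent with the literature; the kit's probes file
(rc 0) shows no cheap battery proves or refutes a cell and no cell or pair of cells recovers B_w or
the root.

Novelty: Searches RUN: lean search / rg in the tree for
'LieIrreducible|lieSubalgebraGL|semisimpleRankOf|IsPotentiallyAbelian|absGaloisRestrict|FramedRep.twist'
(tree: AlgebraicMonodromyLie.lean [Hui2013MRL], InducedGaloisRep.lean, FramedRepTwist.lean;
lens-2-g2 MonodromyDichotomy's IsLieIrreducible/HasFiniteProjectiveImage; PrimitiveRankLadder's
HasSelfTwist); ledger negatives --problem Langlands (no monodromy-type statement); lit search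
--hybrid 'Lie irreducible Galois representation automorphy' / 'algebraic monodromy group potential
automorphy' ([corpus:paper:arxiv-2208.04002 p.8, p.36] Hui 2023; [corpus:paper:arxiv-1805.08383 p.3]
Hui; [corpus:book:katz1990-exponential-sums-differential-equations p.50–53]); lit related/citing
([graph:doi:10.1007/bf01231904] Larsen–Pink 1992; [graph:doi:10.1515/crll.1998.018] Pink 1998); lit
galaxy search 'Lie-irreducible|Lie irreducible|potentially abelian' --star all (no relevant hits:
panama 220417721630793 / 485305534644299 / 246617022136417 off-topic). Nearest prior art: lens-2-g2
MonodromyDichotomy (same organising object; boundary Clifford–Tate structure + transport crux with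
lower-rank hypothesis), PrimitiveRankLadder (self-twist cut at fixed rank), Patrikis arXiv:1207.6724
Prop 4.1.1 (the Lie-isotypic ⊗-decomposition, structure only). Delta: the (G°)^der-ISOTYPY boundary
— the unique monodromy boundary invariant under the extended transfer groupoid (⊗
potentially-abelian data, twists, every finite restriction/descent), giving an exact tric  [refs: 10.1007/bf01231904, 10.1515/crll.1998.018, 1207.6724, paper:arxiv-2208.04002, paper:arxiv-1805.08383, book:katz1990-exponential-sums-differential-equations, doi:10.1007/bf01231904, doi:10.1515/crll.1998.018]

Barriers (technique_class: lie-type carving, automorphy-lifting, automorphic-induction): - technique_class: lie-type carving, automorphy-lifting, automorphic-induction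
- Literature.Barriers.Langlands.SolvableImageBarrier (+Narrow, +NarrowInduction): CARVED ALONG — C₂
is outside its quantifier range by construction (no finite layer with solvable image: (G°)^der ≠ 1
is restriction-invariant, kernel isLieIsotypic_restrictField_iff +
isPotentiallyAbelian_restrictField_iff); C₁ carries its Artin cell (insoluble finite images incl.
the totally even perfect core, conjunct (5)); C₃ carries its NarrowInduction core (insoluble
automorphic induction, given B_w at lower rank) in ℓ-adic form; the bet is none — the barrier is a
map of C₁ ∪ C₃, and the route's content there is IDEA-NEEDED.
- Literature.Barriers.Langlands.NonRegularWeightBarrier: inside for C₁ (Hodge–Tate type 0), for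
irregular members of C₂ and for all of C₃ (inductions have repeated HT weights); evaded nowhere;
placed.
- Literature.Barriers.Langlands.ShimuraVarietyRealizationBarrier / TaylorWilesNumericalCoincidence:
inside for C₂ off CM/TR fields (unavoidable in any orbit-closed cell: CM-ness is not
restriction-invariant); the bet is the potential-automorphy + descent programme, whose
insoluble-descent step is named IDEA-NEEDED.
- Literature.Barriers.Langlands.ResiduallyReducibleBarrier: inside for C₂ at small ℓ (residually
reducible big-monodromy ρ); evaded by changing ℓ only via N0's companions, which the weak a.e. form
does not provide — placed.
- Literature.Barriers.Langlands.TwistedEndoscopySelfDual: bis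

sub-problem: Langlands · status: draft · opened planner-decomp-langlands-writer-1-g2-0 2026-08-30T03:10:34Z · rev 0 · ledger route-Langlands-LieTypeCarving
GENERATED by the gate from the ledger (D-0016/17). Provers cite these decls: `theorem foo : Summit.Langlands.Langlands.Theses.LieTypeCarving.<Decl> := …` in Summits/Langlands/Langlands/Theorems/<Name>.lean.
-/

namespace Summit.Langlands.Langlands.Theses.LieTypeCarving

open scoped BigOperators Topology Manifold Classical MeasureTheory ProbabilityTheory Matrix InnerProductSpace ComplexConjugate ContinuousMap
open Filter Set Function TopologicalSpace MeasureTheory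

attribute [summit_statement] _root_.Langlands

/-- item stmt-Langlands-26373 · crux · rank 2 · open · by planner
why it might fail: It is strong Artin ∪ Hecke reciprocity in every rank: even icosahedral Artin reps of Γ_ℚ and primitive insoluble images in rank ≥ 3 have no known automorphic realisation (no Shimura variety, no odd weight-one trick); a non-automorphic one refutes it.
sources: Langlands1980BaseChange, Tunnell1981, ArthurClozel1989, KhareWintenberger2009, PilloniStroh2016, Calegari2023
[crux] [NEW · C₁ of the Lie-type carving of B_w = stmt-Langlands-17414 (decomp-langlands lens-6 gen
2, node nodes/lens-6-g2-LieTypeCarving.lean); OPEN; WEAKER (B_w ⇒ C₁; ⇏: omits ρ_E over non-CM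
quartic K and no twist/base change/descent enters the cell — kernel isPotentiallyAbelian_twist_iff /
_restrictField_iff in the node); leaves ATTACKABLE (n = 1 = stmt-Langlands-24805 print; n = 2
solvable image strongArtin_of_isSolvable_of_cases; totally odd TR
strongArtin_of_isOdd_rat_of_pilloniStroh; nilpotent Arthur–Clozel; cyclic CM-inductions
automorphicInduction_cyclic_cuspidal) · INSTRUMENTABLE (census P26/P9 certified Maass/Artin-L
censuses) · BARRIER SolvableImageBarrierNarrowInduction_holds (insoluble finite images; totally even
core = stmt-Langlands-2903, HC1 box) + NonRegularWeightBarrier_holds · IDEA-NEEDED (even insoluble,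
n ≥ 3 primitive)] ARTIN–HECKE RECIPROCITY, weak a.e. form: every irreducible, a.e.-unramified,
pinned-de-Rham ρ : Γ_K → GL_n(ℚ̄_ℓ) that is POTENTIALLY ABELIAN (some open subgroup of Γ_K has
commutative image: Artin representations, algebraic Hecke characters, their inductions and tensor
products) is Satake–Frobenius compatible a.e. with an L-algebraic cuspida -/
@[route_item "route-Langlands-LieTypeCarving", crux]
def ArtinHeckeAutomorphy : Prop :=
  ∀ (K : Type) [Field K] [NumberField K] (n : ℕ) (hcpt : Literature.NumberTheory.Automorphic.isCompact_glFiniteIntegralLevel n K), 0 < n → ∀ (ℓ : ℕ) [Fact ℓ.Prime] (ι : PadicAlgCl ℓ ≃+* ℂ) (ρ : Literature.NumberTheory.GaloisRepresentations.FramedGaloisRep K (PadicAlgCl ℓ) n), (∃ H : Subgroup (Field.absoluteGaloisGroup K), IsOpen (H : Set (Field.absoluteGaloisGroup K)) ∧ ∀ g ∈ H, ∀ h ∈ H, ρ g * ρ h = ρ h * ρ g) → ρ.toGaloisRep.IsIrreducible → ((∀ᶠ v : IsDedekindDomain.HeightOneSpectrum (NumberField.RingOfIntegers K) in cofinite, ρ.IsUnramifiedAt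 v) ∧ ∀ (v : IsDedekindDomain.HeightOneSpectrum (NumberField.RingOfIntegers K)) (hv : ((ℓ : ℕ) : NumberField.RingOfIntegers K) ∈ v.asIdeal), (Literature.NumberTheory.PAdicHodge.fontainePstAdicCompletion v ℓ hv).IsDeRhamFramed (ρ.toLocal v)) → ∃ π : Literature.NumberTheory.Automorphic.CuspidalAutomorphicRepData n K hcpt, π.1.IsLAlgebraic ∧ ∀ᶠ v : IsDedekindDomain.HeightOneSpectrum (NumberField.RingOfIntegers K) in cofinite, SatakeFrobCompatibleAt ι π.1 ρ v

/-- item stmt-Langlands-26374 · crux · rank 3 · open · by planner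
why it might fail: Contains Fontaine–Mazur–Langlands for non-CM elliptic curves over arbitrary K and for irregular Lie-irreducible ρ: lifting needs regular weights, adequate ρ̄, a CM/TR field, and gives potential automorphy only (BLGGT 4.2.1); insoluble descent is unknown.
sources: FontaineMazurGeometric1995, Kisin2009, BarnetlambEtAl2014, ACCGHLNSTT2023, arXiv:1207.6724, doi:10.1007/bf01231904
[crux] [NEW · C₂ of the Lie-type carving of B_w = stmt-Langlands-17414; OPEN; WEAKER (B_w ⇒ C₂; ⇏:
omits every even icosahedral Artin ρ/ℚ and every insoluble-closure induction, and no twist/base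
change/descent enters the cell — kernel isLieIsotypic_twist_iff / _restrictField_iff); BY
CONSTRUCTION OUTSIDE Literature.Barriers.Langlands.SolvableImageBarrier* (no finite layer makes ρ
solvable-image or a sum of characters); leaves ATTACKABLE (n = 2, K = ℚ odd:
XZhang2024_fontaineMazurGL2_tateTwist, Pan2022_proModularDeRhamClassical_GL2Q,
Tung2020_fontaineMazurGL2_two_tateTwist; even regular VOID Calegari2011_thm_1_2; regular polarizable
CM/TR potentially automorphic BLGGT2014_thmC_potentialAutomorphy) · IDEA-NEEDED (residual automorphy
of Lie-irreducible lifts; insoluble descent potential ⇒ actual) · BARRIER placed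
NonRegularWeightBarrier_holds, ShimuraVarietyRealizationBarrier_holds,
TaylorWilesNumericalCoincidence_holds, ResiduallyReducibleBarrier_holds,
TwistedEndoscopySelfDual_holds] LIE-ISOTYPIC RECIPROCITY, weak a.e. form: every irreducible,
a.e.-unramified, pinned-de-Rham ρ : Γ_K → GL_n(ℚ̄_ℓ) that is NOT potentially abelian and is
LIE-ISOTYPIC (on every small open subgroup H the -/
@[route_item "route-Langlands-LieTypeCarving", crux]
def LieIsotypicAutomorphy : Prop :=
  ∀ (K : Type) [Field K] [NumberField K] (n : ℕ) (hcpt : Literature.NumberTheory.Automorphic.isCompact_glFiniteIntegralLevel n K), 0 < n → ∀ (ℓ : ℕ) [Fact ℓ.Prime] (ι : PadicAlgCl ℓ ≃+* ℂ) (ρ : Literature.NumberTheory.GaloisRepresentations.FramedGaloisRep K (PadicAlgCl ℓ) n), ¬ (∃ H : Subgroup (Field.absoluteGaloisGroup K), IsOpen (H : Set (Field.absoluteGaloisGroup K)) ∧ ∀ g ∈ H, ∀ h ∈ H, ρ g * ρ h = ρ h * ρ g) → (∃ H₀ : Subgroup (Field.absoluteGaloisGroup K), IsOpen (H₀ : Set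 (Field.absoluteGaloisGroup K)) ∧ ∀ H : Subgroup (Field.absoluteGaloisGroup K), IsOpen (H : Set (Field.absoluteGaloisGroup K)) → H ≤ H₀ → ∀ f : Matrix (Fin n) (Fin n) (PadicAlgCl ℓ), (∀ g ∈ ⁅H, H⁆, f * ((ρ g : GL (Fin n) (PadicAlgCl ℓ)) : Matrix (Fin n) (Fin n) (PadicAlgCl ℓ)) = ((ρ g : GL (Fin n) (PadicAlgCl ℓ)) : Matrix (Fin n) (Fin n) (PadicAlgCl ℓ)) * f) → (∀ f' : Matrix (Fin n) (Fin n) (PadicAlgCl ℓ), (∀ g ∈ ⁅H, H⁆, f' * ((ρ g : GL (Fin n) (PadicAlgCl ℓ)) : Matrix (Fin n) (Fin n) (PadicAlgCl ℓ)) = ((ρ g : GL (Fin n) (PadicAlgCl ℓ)) : Matrix (Fin n) (Fin n) (PadicAlgCl ℓ)) * f') → f * f' = f' * f) → f ∈ Set.range (Matrix.scalar (Fin n) : PadicAlgCl ℓ → Matrix (Fin n) (Fin n) (PadicAlgCl ℓ))) → ρ.toGaloisRep.IsIrreducible → ((∀ᶠ v : IsDedekindDomain.HeightOneSpectrum (NumberField.RingOfIntegers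 K) in cofinite, ρ.IsUnramifiedAt v) ∧ ∀ (v : IsDedekindDomain.HeightOneSpectrum (NumberField.RingOfIntegers K)) (hv : ((ℓ : ℕ) : NumberField.RingOfIntegers K) ∈ v.asIdeal), (Literature.NumberTheory.PAdicHodge.fontainePstAdicCompletion v ℓ hv).IsDeRhamFramed (ρ.toLocal v)) → ∃ π : Literature.NumberTheory.Automorphic.CuspidalAutomorphicRepData n K hcpt, π.1.IsLAlgebraic ∧ ∀ᶠ v : IsDedekindDomain.HeightOneSpectrum (NumberField.RingOfIntegers K) in cofinite, SatakeFrobCompatibleAt ι π.1 ρ v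

/-- item stmt-Langlands-26375 · crux · rank 4 · open · by planner
why it might fail: Even given B_w at all lower ranks it is automorphic induction along extensions with INSOLUBLE Galois closure (n ≥ 10), open in every rank (no trace-formula comparison off solvable towers; Dedekind's conjecture for an A₅-quintic is open); one non-automorphic Ind_{K₁}^{K} ρ₁ refutes it.
sources: ArthurClozel1989, JPSS1981GL3, Harris1998, Calegari2023, Clifford1937
[crux] [NEW · C₃ of the Lie-type carving of B_w = stmt-Langlands-17414, TRANSPORT form (v2, crit-1
02:53:07Z fix F1); OPEN; WEAKER (B_w ⇒ C₃ ignoring the hypothesis; ⇏: vacuous in ranks ≤ 3, silent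
on the potentially-abelian and Lie-isotypic classes in every rank; no twist/restriction enters the
class — kernel isLieIsotypic_twist_iff / _restrictField_iff —, automorphic induction enters only
from LOWER rank = the hypothesis)] LIE-IMPRIMITIVE TRANSPORT: for every number field K, n ≥ 1, ℓ, ι:
GIVEN weak geometric automorphy (B_w) at every rank m < n over every number field, every irreducible
a.e.-unramified pinned-de-Rham ρ : Γ_K → GL_n(ℚ̄_ℓ) whose restriction to the derived group of the
identity component of its algebraic monodromy group is NOT isotypic (typed: not derived-isotypic on
small open subgroups) is Satake–Frobenius compatible a.e. with an L-algebraic cuspidal π of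
GL_n(𝔸_K). By Clifford such ρ ≅ Ind_{K₁}^{K} ρ₁, [K₁:K] ≥ 2, ρ₁ Lie-isotypic of rank n/[K₁:K] < n
(covered by the hypothesis); the obligation is the induction step K₁ → K: print for [K₁:K] = 2
(automorphicInduction_cyclic_cuspidal; cf. stmt-Langlands-24806), non-normal cubic (JPSS) and
subnormal solvable towers ( -/
@[route_item "route-Langlands-LieTypeCarving", crux]
def LieImprimitiveTransport : Prop :=
  ∀ (K : Type) [Field K] [NumberField K] (n : ℕ) (hcpt : Literature.NumberTheory.Automorphic.isCompact_glFiniteIntegralLevel n K), 0 < n → ∀ (ℓ : ℕ) [Fact ℓ.Prime] (ι : PadicAlgCl ℓ ≃+* ℂ) (ρ : Literature.NumberTheory.GaloisRepresentations.FramedGaloisRep K (PadicAlgCl ℓ) n), ¬ (∃ H₀ : Subgroup (Field.absoluteGaloisGroup K), IsOpen (H₀ : Set (Field.absoluteGaloisGroup K)) ∧ ∀ H : Subgroup (Field.absoluteGaloisGroup K), IsOpen (H : Set (Field.absoluteGaloisGroup K)) → H ≤ H₀ → ∀ f : Matrix (Fin n) (Fin n) (PadicAlgCl ℓ), (∀ g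 ∈ ⁅H, H⁆, f * ((ρ g : GL (Fin n) (PadicAlgCl ℓ)) : Matrix (Fin n) (Fin n) (PadicAlgCl ℓ)) = ((ρ g : GL (Fin n) (PadicAlgCl ℓ)) : Matrix (Fin n) (Fin n) (PadicAlgCl ℓ)) * f) → (∀ f' : Matrix (Fin n) (Fin n) (PadicAlgCl ℓ), (∀ g ∈ ⁅H, H⁆, f' * ((ρ g : GL (Fin n) (PadicAlgCl ℓ)) : Matrix (Fin n) (Fin n) (PadicAlgCl ℓ)) = ((ρ g : GL (Fin n) (PadicAlgCl ℓ)) : Matrix (Fin n) (Fin n) (PadicAlgCl ℓ)) * f') → f * f' = f' * f) → f ∈ Set.range (Matrix.scalar (Fin n) : PadicAlgCl ℓ → Matrix (Fin n) (Fin n) (PadicAlgCl ℓ))) → ρ.toGaloisRep.IsIrreducible → ((∀ᶠ v : IsDedekindDomain.HeightOneSpectrum (NumberField.RingOfIntegers K) in cofinite, ρ.IsUnramifiedAt v) ∧ ∀ (v : IsDedekindDomain.HeightOneSpectrum (NumberField.RingOfIntegers K)) (hv : ((ℓ : ℕ) : NumberField.RingOfIntegers K) ∈ v.asIdeal), (Literature.NumberTheory.PAdicHodge.fontainePstAdicCompletion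 v ℓ hv).IsDeRhamFramed (ρ.toLocal v)) → (∀ m : ℕ, m < n → ∀ (K : Type) [Field K] [NumberField K] (hcpt : Literature.NumberTheory.Automorphic.isCompact_glFiniteIntegralLevel m K), 0 < m → ∀ (ℓ : ℕ) [Fact ℓ.Prime] (ι : PadicAlgCl ℓ ≃+* ℂ) (ρ : Literature.NumberTheory.GaloisRepresentations.FramedGaloisRep K (PadicAlgCl ℓ) m), ρ.toGaloisRep.IsIrreducible → ((∀ᶠ v : IsDedekindDomain.HeightOneSpectrum (NumberField.RingOfIntegers K) in cofinite, ρ.IsUnramifiedAt v) ∧ ∀ (v : IsDedekindDomain.HeightOneSpectrum (NumberField.RingOfIntegers K)) (hv : ((ℓ : ℕ) : NumberField.RingOfIntegers K) ∈ v.asIdeal), (Literature.NumberTheory.PAdicHodge.fontainePstAdicCompletion v ℓ hv).IsDeRhamFramed (ρ.toLocal v)) → ∃ π : Literature.NumberTheory.Automorphic.CuspidalAutomorphicRepData m K hcpt, π.1.IsLAlgebraic ∧ ∀ᶠ v : IsDedekindDomain.HeightOneSpectrum (NumberField.RingOfIntegers K) in cofinite, SatakeFrobCompatibleAt ι π.1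 ρ v) → ∃ π : Literature.NumberTheory.Automorphic.CuspidalAutomorphicRepData n K hcpt, π.1.IsLAlgebraic ∧ ∀ᶠ v : IsDedekindDomain.HeightOneSpectrum (NumberField.RingOfIntegers K) in cofinite, SatakeFrobCompatibleAt ι π.1 ρ v

/-- item stmt-Langlands-17415 · crux · rank 5 · open · by planner
why it might fail: Galois representations for non-cohomological π (Maass forms of eigenvalue 1/4, mixed-signature fields) and irreducibility of r_π for n ≥ 3 are open.
sources: BuzzardGeeLMS2014, HarrisLanTaylorThorneRMS2016, Scholze2015
[crux] W⁺ — for every number field K, n ≥ 1, every L-algebraic cuspidal π of GL_n(𝔸_K) and every (ℓ,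
ι) there is an IRREDUCIBLE ρ : Γ_K → GL_n(ℚ̄_ℓ) Satake–Frobenius compatible with (π, ι) at almost
all places (Buzzard–Gee Conj. 3.2.2 weak form + Ramakrishnan's cuspidal ⇒ irreducible; Clozel's
Conj. 1.1.1 in arXiv:2607.11763). No de Rham clause, no Rec: ε-free and Rec-free. [difficulty:
open-problem] -/
@[route_item "route-Langlands-LieTypeCarving", crux]
def SatakeAvatarExistence : Prop :=
  ∀ (K : Type) [Field K] [NumberField K] (n : ℕ) (hcpt : Literature.NumberTheory.Automorphic.isCompact_glFiniteIntegralLevel n K), 0 < n → ∀ (π : Literature.NumberTheory.Automorphic.CuspidalAutomorphicRepData n K hcpt), π.1.IsLAlgebraic → ∀ (ℓ : ℕ) [Fact ℓ.Prime] (ι : PadicAlgCl ℓ ≃+* ℂ), ∃ ρ : Literature.NumberTheory.GaloisRepresentations.FramedGaloisRep K (PadicAlgCl ℓ) n, ρ.toGaloisRep.IsIrreducible ∧ ∀ᶠ v : IsDedekindDomain.HeightOneSpectrum (NumberField.RingOfIntegers K) in cofinite, SatakeFrobCompatibleAt ι π.1 ρ v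

/-- item stmt-Langlands-17534 · crux · rank 6 · open · by planner
why it might fail: ℓ = p compatibility for torsion-limit representations is known only up to semisimplification (AHTW 2026 Thm 1.2.1, regular π over CM); the monodromy at p, irregular π and general K are open.
sources: FontaineAsterisque223VIII, Caraiani2014, AHTW2026, arXiv:math/0612077
[crux] P — the PRIME-SWITCH PRINCIPLE for the p-adic member of the automorphic compatible system
(Rec-parametric, Rec-free in content; rev 1, cone repair: stated over the summit's own predicates
only): for π L-algebraic cuspidal on GL_n/K, ρ an irreducible ℓ-adic avatar of (π, ι)
(Satake–Frobenius compatible a.e.) and a place v ∣ ℓ: (i) ρ|_v is de Rham for Fontaine's pinned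
datum; (ii) for EVERY reciprocity datum Rec, every prime ℓ' ∤ v, ι' and every irreducible ℓ'-adic
avatar ρ' of (π, ι'), local–global compatibility of (π, ρ') at v for Rec (read ℓ'-adically,
Grothendieck–Deligne) implies local–global compatibility of (π, ρ) at v for Rec (read through
D_pst). Mathematically (ii) is Fontaine's C_WD for the system {ρ_(π,ι)}: the
Frobenius-semisimplified Weil–Deligne representation at v of the p-adic member, computed by D_pst,
is the common one of the ℓ'-adic members (Saito arXiv:math/0612077 for Hilbert modular forms;
Caraiani 2012/2014 for Shimura varieties; AHTW 2026 Thm 1.2.1 up to semisimplification for regular π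
over CM). Kernel-certified consequence of `Langlands` (bc/SubsOfLanglands.lean); with L∤ at (π, ι',
ρ') it is Taylor's Conj. 7 at v ∣ ℓ — the glue's patching lemma. -/
@[route_item "route-Langlands-LieTypeCarving", crux]
def PadicMemberCompatibility : Prop :=
  ∀ (K : Type) [Field K] [NumberField K] (n : ℕ) (hcpt : Literature.NumberTheory.Automorphic.isCompact_glFiniteIntegralLevel n K), 0 < n → ∀ (π : Literature.NumberTheory.Automorphic.CuspidalAutomorphicRepData n K hcpt), π.1.IsLAlgebraic → ∀ (ℓ : ℕ) [Fact ℓ.Prime] (ι : PadicAlgCl ℓ ≃+* ℂ) (ρ : Literature.NumberTheory.GaloisRepresentations.FramedGaloisRep K (PadicAlgCl ℓ) n), ρ.toGaloisRep.IsIrreducible → (∀ᶠ v : IsDedekindDomain.HeightOneSpectrum (NumberField.RingOfIntegers K) in cofinite, SatakeFrobCompatibleAt ι π.1 ρ v) → ∀ (v : IsDedekindDomain.HeightOneSpectrum (NumberField.RingOfIntegers K)) (hv : ((ℓ : ℕ) : NumberField.RingOfIntegers K) ∈ v.asIdeal), (Literature.NumberTheory.PAdicHodge.fontainePstAdicCompletion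 v ℓ hv).IsDeRhamFramed (ρ.toLocal v) ∧ ∀ (Rec : ReciprocityData K) (ℓ' : ℕ) [Fact ℓ'.Prime] (ι' : PadicAlgCl ℓ' ≃+* ℂ) (ρ' : Literature.NumberTheory.GaloisRepresentations.FramedGaloisRep K (PadicAlgCl ℓ') n), ((ℓ' : ℕ) : NumberField.RingOfIntegers K) ∉ v.asIdeal → ρ'.toGaloisRep.IsIrreducible → (∀ᶠ w : IsDedekindDomain.HeightOneSpectrum (NumberField.RingOfIntegers K) in cofinite, SatakeFrobCompatibleAt ι' π.1 ρ' w) → LocalGlobalCompatibleAt Rec ι' π.1 ρ' v → LocalGlobalCompatibleAt Rec ι π.1 ρ v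

/-- item stmt-Langlands-18084 · crux · rank 7 · open · by planner
why it might fail: full local–global compatibility (monodromy operator N) at v ∤ ℓ is open in the non-polarizable / torsion settings (Varma gives it up to semisimplification).
sources: TaylorGaloisRepresentations2004, HarrisTaylorAMS2001, HenniartInventiones2000, VarmaFMS2024
[crux] L∤R — Taylor 2004 Conj. 7 at the places v ∤ ℓ, in the `∀ Rec` form (rev 4, lockstep re-type
after the summit re-type p141787 `∀ F, Nonempty (ReciprocityData F) ∧ ∀ 𝓡 …`): for every number
field K and EVERY reciprocity datum Rec (Henniart-normalised local Langlands data with THE canonical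
Artin pins — the summit's `∀ 𝓡`), every n ≥ 1 and hcpt, every L-algebraic cuspidal π of GL_n(𝔸_K),
every (ℓ, ι) and every IRREDUCIBLE ρ : Γ_K → GL_n(ℚ̄_ℓ) that is pinned-geometric (unramified a.e.,
de Rham above ℓ for Fontaine's pinned datum) and Satake–Frobenius compatible with (π, ι) a.e.:
`LocalGlobalCompatibleAt Rec ι π ρ v` at every finite v ∤ ℓ (Grothendieck–Deligne Weil–Deligne
representation, Frobenius-semisimplified, ↔ rec_v(π_v)). = item L∤ (stmt-Langlands-17417, ∃-Rec
form; verbatim the registered stub `stub_pairCompatibilityAway` of line `Sketch` of crux 14328) with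
Rec moved from `∃ Rec,` to a universal binder after K and nothing else changed; the ∃-form is
implied back by L∤R ∧ CanonicalReciprocityData (`compatibilityAwayFromL_existsForm`).
Kernel-certified consequence of the re-typed summit (`compatibilityAwayFromLR_of_langlands`, planner
bc/SubsOfLanglandsR.lean: direction (A -/
@[route_item "route-Langlands-LieTypeCarving", crux]
def CompatibilityAwayFromLR : Prop :=
  ∀ (K : Type) [Field K] [NumberField K] (Rec : ReciprocityData K) (n : ℕ) (hcpt : Literature.NumberTheory.Automorphic.isCompact_glFiniteIntegralLevel n K), 0 < n → ∀ (π : Literature.NumberTheory.Automorphic.CuspidalAutomorphicRepData n K hcpt), π.1.IsLAlgebraic → ∀ (ℓ : ℕ) [Fact ℓ.Prime] (ι : PadicAlgCl ℓ ≃+* ℂ) (ρ : Literature.NumberTheory.GaloisRepresentations.FramedGaloisRep K (PadicAlgCl ℓ) n), ρ.toGaloisRep.IsIrreducible → ((∀ᶠ v : IsDedekindDomain.HeightOneSpectrum (NumberField.RingOfIntegers K) in cofinite, ρ.IsUnramifiedAt v) ∧ ∀ (v : IsDedekindDomain.HeightOneSpectrum (NumberField.RingOfIntegers K)) (hv : ((ℓ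 : ℕ) : NumberField.RingOfIntegers K) ∈ v.asIdeal), (Literature.NumberTheory.PAdicHodge.fontainePstAdicCompletion v ℓ hv).IsDeRhamFramed (ρ.toLocal v)) → (∀ᶠ v : IsDedekindDomain.HeightOneSpectrum (NumberField.RingOfIntegers K) in cofinite, SatakeFrobCompatibleAt ι π.1 ρ v) → ∀ v : IsDedekindDomain.HeightOneSpectrum (NumberField.RingOfIntegers K), ((ℓ : ℕ) : NumberField.RingOfIntegers K) ∉ v.asIdeal → LocalGlobalCompatibleAt Rec ι π.1 ρ v

/-- item stmt-Langlands-17930 · support · rank 9 · open · by planner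
sources: HarrisTaylorAMS2001, HenniartInventiones2000, Deligne1973Constantes
[support] THE SUMMIT'S NON-VACUITY CONJUNCT, verbatim (statement revision p141787, 2026-08-17:
`Langlands := ∀ F, Nonempty (ReciprocityData F) ∧ ∀ 𝓡 n, 0 < n → ∀ hcpt, GLC n F 𝓡 hcpt`, with
`ReciprocityData` pinned to THE local Artin maps by `llc_isCanonical` / `llc_eps_isCanonical`),
filed by route-repair 5a1bd9af as the explicit INPUT of this route's `∃ RD`-shaped slices
(LiftB2Unram, LiftB2UnramSmallF, LiftB2UnramLargeF, LiftB2UnramSplitP): for every number field F and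
every finite place v, a local Langlands datum for GL_n(F_v) (Harris–Taylor 2001 Thm A; Henniart 2000
Thm 1.2) normalised against THE local Artin map `canonicalArtin (F_v)`, whose ε-system (Deligne 1973
Thm 4.1) is normalised against the canonical Artin map of every finite E/F_v. IN PRINT,
textbook-grade input (Harris–Taylor's Thm A is stated relative to Art_K of local class field
theory); in the TREE not yet derivable — `LocalLanglandsDatum.nonempty` (cite-only) yields a datum
with SOME lawful Artin normalisation, and canonicity needs `IsLocalArtinMap.unique` + the
finite-level reciprocity law for that datum's Artin maps, or canonical variants of
`localLanglands_gl` / `nonempty_localEpsilonSystem` (needs-fact for -/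
@[route_item "route-Langlands-LieTypeCarving", crux]
def CanonicalReciprocityData : Prop :=
  ∀ (F : Type) [Field F] [NumberField F], Nonempty (Summit.Langlands.ReciprocityData F)

/-- item stmt-Langlands-26376 · assembly · rank 1 · closed · proved by Summit.Langlands.Langlands.Theorems.lieTypeCarving_assembly_proof (prover) · by planner
why it might fail: Only through a typing slip in the inlined predicates; `closes` is certified natively and the node proves B_w ↔ C₁ ∧ C₂ ∧ C₃ with standard axioms.
sources: D-0027, D-0178
[assembly] Langlands ⟸ C₁ ∧ C₂ ∧ C₃ ∧ W⁺ ∧ P ∧ L∤R ∧ CRD: level 2 = B_w (stmt-Langlands-17414)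
re-derived from the three Lie-type cells by excluded middle on the Lie type (kernel weak_of_cells /
weakGeometricAutomorphy_iff_cells of the node), level 1 = N0 = PrimeSwitchSplit rev 4 verbatim
(prime switch ℓ' ∈ {2,3} + avatar transport; U = AvatarConjugacy stmt-Langlands-17844 is the landed
theorem stub_avatarConjugacy). -/
@[route_item "route-Langlands-LieTypeCarving"]
def Assembly : Prop :=
  ArtinHeckeAutomorphy → LieIsotypicAutomorphy → LieImprimitiveTransport → SatakeAvatarExistence → PadicMemberCompatibility → CompatibilityAwayFromLR → CanonicalReciprocityData → _root_.Langlands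

-- `Assembly` holds: proved by `Summit.Langlands.Langlands.Theorems.lieTypeCarving_assembly_proof` (its module imports this route file, so no `_holds` link can be stated here).

/-! D-0027 §2.1 — DECIDING THEOREM (planner-authored via `route open/edit --closes-file`; by planner-decomp-langlands-writer-1-g2-0 2026-08-30T03:10:34Z):
its hypotheses are this route's items and its conclusion the sub-problem Statement (glue_lint), and it elaborates with this file. -/

/- (spliced by the gate into the rendered route file via `--closes-file`; not a standalone module — certify with
   `ledger route check --native route.json --closes-file glue.lean`)
   D-0027 §2.1 deciding theorem for route LieTypeCarving (decomp-langlands lens-6 gen 2).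
   Self-contained over the INLINED one-liner items (no helper lemmas).  Level 2 = B_w (stmt-Langlands-17414) by excluded
   middle on the Lie type of ρ at each rank inside a STRONG INDUCTION on the rank (potentially abelian → ArtinHeckeAutomorphy |
   not PA ∧ Lie-isotypic → LieIsotypicAutomorphy | else → LieImprimitiveTransport fed with the induction hypothesis) — the node's
   `weakAutomorphyAtRank_all` (v2, crit-1 02:53:07Z fix F1); level 1 = N0 = PrimeSwitchSplit rev 4 verbatim (prime
   switch ℓ' ∈ {2,3} + avatar transport; U := the landed theorem
   `Theorems.EisensteinDegreeShiftSectorComplement.stub_avatarConjugacy`), byte-identical to the certified glue of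
   nodes/lens-6-g0-MonodromyCarving.glue.lean from `intro F _ _` on. -/
@[closes "route-Langlands-LieTypeCarving"] theorem closes (h₁ : ArtinHeckeAutomorphy) (h₂ : LieIsotypicAutomorphy) (h₃ : LieImprimitiveTransport)
    (hW : SatakeAvatarExistence) (hP : PadicMemberCompatibility) (hA : CompatibilityAwayFromLR)
    (hR : CanonicalReciprocityData) : _root_.Langlands := by
  -- `Assembly` (item) is literally the curried form of this theorem: prove it, then apply it (writer convention).
  suffices hAsm : Assembly from hAsm h₁ h₂ h₃ hW hP hA hR
  clear h₁ h₂ h₃ hW hP hA hR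
  intro h₁ h₂ h₃ hW hP hA hR
  have hU := @_root_.Summit.Langlands.Langlands.Theorems.EisensteinDegreeShiftSectorComplement.stub_avatarConjugacy
  -- LEVEL 2: B_w at every rank from the three Lie-type cells, by strong induction on the rank (= the node's `weakAutomorphyAtRank_all`)
  have hB : ∀ (m : ℕ), ∀ (K : Type) [Field K] [NumberField K] (hcpt : Literature.NumberTheory.Automorphic.isCompact_glFiniteIntegralLevel m K), 0 < m → ∀ (ℓ : ℕ) [Fact ℓ.Prime] (ι : PadicAlgCl ℓ ≃+* ℂ) (ρ : Literature.NumberTheory.GaloisRepresentations.FramedGaloisRep K (PadicAlgCl ℓ) m), ρ.toGaloisRep.IsIrreducible → ((∀ᶠ v : IsDedekindDomain.HeightOneSpectrum (NumberField.RingOfIntegers K) in cofinite, ρ.IsUnramifiedAt v) ∧ ∀ (v : IsDedekindDomain.HeightOneSpectrum (NumberField.RingOfIntegers K)) (hv : ((ℓ : ℕ) : NumberField.RingOfIntegers K) ∈ v.asIdeal), (Literature.NumberTheory.PAdicHodge.fontainePstAdicCompletion v ℓ hv).IsDeRhamFramed (ρ.toLocal v)) → ∃ π : Literature.NumberTheory.Automorphic.CuspidalAutomorphicRepData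 m K hcpt, π.1.IsLAlgebraic ∧ ∀ᶠ v : IsDedekindDomain.HeightOneSpectrum (NumberField.RingOfIntegers K) in cofinite, SatakeFrobCompatibleAt ι π.1 ρ v := by
    intro m
    induction m using Nat.strong_induction_on with
    | _ n ih =>
      intro K _ _ hcpt hn ℓ _ ι ρ hirr hgeo
      by_cases hPA : (∃ H : Subgroup (Field.absoluteGaloisGroup K), IsOpen (H : Set (Field.absoluteGaloisGroup K)) ∧ ∀ g ∈ H, ∀ h ∈ H, ρ g * ρ h = ρ h * ρ g)
      · exact h₁ K n hcpt hn ℓ ι ρ hPA hirr hgeo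
      · by_cases hLie : (∃ H₀ : Subgroup (Field.absoluteGaloisGroup K), IsOpen (H₀ : Set (Field.absoluteGaloisGroup K)) ∧ ∀ H : Subgroup (Field.absoluteGaloisGroup K), IsOpen (H : Set (Field.absoluteGaloisGroup K)) → H ≤ H₀ → ∀ f : Matrix (Fin n) (Fin n) (PadicAlgCl ℓ), (∀ g ∈ ⁅H, H⁆, f * ((ρ g : GL (Fin n) (PadicAlgCl ℓ)) : Matrix (Fin n) (Fin n) (PadicAlgCl ℓ)) = ((ρ g : GL (Fin n) (PadicAlgCl ℓ)) : Matrix (Fin n) (Fin n) (PadicAlgCl ℓ)) * f) → (∀ f' : Matrix (Fin n) (Fin n) (PadicAlgCl ℓ), (∀ g ∈ ⁅H, H⁆, f' * ((ρ g : GL (Fin n) (PadicAlgCl ℓ)) : Matrix (Fin n) (Fin n) (PadicAlgCl ℓ)) = ((ρ g : GL (Fin n) (PadicAlgCl ℓ)) : Matrix (Fin n) (Fin n) (PadicAlgCl ℓ)) * f') → f * f' = f' * f) → f ∈ Set.range (Matrix.scalar (Fin n) : PadicAlgCl ℓ → Matrix (Fin n) (Fin n) (PadicAlgCl ℓ)))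
        · exact h₂ K n hcpt hn ℓ ι ρ hPA hLie hirr hgeo
        · exact h₃ K n hcpt hn ℓ ι ρ hLie hirr hgeo (fun m hm => ih m hm)
  -- LEVEL 1: the frame of record (N0 = PrimeSwitchSplit rev 4), verbatim
  intro F _ _
  refine ⟨hR F, fun Rec n hn hcpt => ?_⟩
  have hRec := hA F Rec
  -- every finite place misses the prime 2 or the prime 3
  have hprime : ∀ v : IsDedekindDomain.HeightOneSpectrum (NumberField.RingOfIntegers F),
      ∃ (ℓ' : ℕ) (_ : Fact ℓ'.Prime), ((ℓ' : ℕ) : NumberField.RingOfIntegers F) ∉ v.asIdeal := by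
    intro v
    by_cases h2 : ((2 : ℕ) : NumberField.RingOfIntegers F) ∈ v.asIdeal
    · refine ⟨3, ⟨Nat.prime_three⟩, fun h3 => v.isPrime.ne_top ((Ideal.eq_top_iff_one _).2 ?_)⟩
      have h := v.asIdeal.sub_mem h3 h2
      have h1 : ((3 : ℕ) : NumberField.RingOfIntegers F) - ((2 : ℕ) : NumberField.RingOfIntegers F) = 1 := by
        push_cast; norm_num
      rwa [h1] at h
    · exact ⟨2, ⟨Nat.prime_two⟩, h2⟩
  -- geometric + compatible at EVERY finite place for irreducible Satake–Frobenius compatible pairs;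
  -- above ℓ the place is read through a prime below it (the prime switch, N0 = PrimeSwitchSplit)
  have hLGC : ∀ (π : Literature.NumberTheory.Automorphic.CuspidalAutomorphicRepData n F hcpt), π.1.IsLAlgebraic →
      ∀ (ℓ : ℕ) [Fact ℓ.Prime] (ι : PadicAlgCl ℓ ≃+* ℂ)
        (ρ : Literature.NumberTheory.GaloisRepresentations.FramedGaloisRep F (PadicAlgCl ℓ) n),
        ρ.toGaloisRep.IsIrreducible →
        (∀ᶠ v : IsDedekindDomain.HeightOneSpectrum (NumberField.RingOfIntegers F) in Filter.cofinite,
          SatakeFrobCompatibleAt ι π.1 ρ v) →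
        IsGeometricFramed Rec ρ ∧
          ∀ v : IsDedekindDomain.HeightOneSpectrum (NumberField.RingOfIntegers F),
            LocalGlobalCompatibleAt Rec ι π.1 ρ v := by
    intro π hL ℓ _ ι ρ hirr hρ
    have hgeo : (∀ᶠ v : IsDedekindDomain.HeightOneSpectrum (NumberField.RingOfIntegers F) in Filter.cofinite,
        ρ.IsUnramifiedAt v) ∧
        ∀ (v : IsDedekindDomain.HeightOneSpectrum (NumberField.RingOfIntegers F))
          (hv : ((ℓ : ℕ) : NumberField.RingOfIntegers F) ∈ v.asIdeal),
          (Literature.NumberTheory.PAdicHodge.fontainePstAdicCompletion v ℓ hv).IsDeRhamFramed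
            (ρ.toLocal v) :=
      ⟨hρ.mono fun v ⟨_, _, hur, _⟩ => hur, fun v hv => (hP F n hcpt hn π hL ℓ ι ρ hirr hρ v hv).1⟩
    refine ⟨hgeo, fun v => ?_⟩
    by_cases hv : ((ℓ : ℕ) : NumberField.RingOfIntegers F) ∈ v.asIdeal
    · obtain ⟨ℓ', _, hℓ'⟩ := hprime v
      obtain ⟨ι'⟩ := PadicAlgCl.nonempty_ringEquiv_complex ℓ'
      obtain ⟨ρ', hirr', hρ'⟩ := hW F n hcpt hn π hL ℓ' ι'
      have hgeo' : (∀ᶠ w : IsDedekindDomain.HeightOneSpectrum (NumberField.RingOfIntegers F) in Filter.cofinite,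
          ρ'.IsUnramifiedAt w) ∧
          ∀ (w : IsDedekindDomain.HeightOneSpectrum (NumberField.RingOfIntegers F))
            (hw : ((ℓ' : ℕ) : NumberField.RingOfIntegers F) ∈ w.asIdeal),
            (Literature.NumberTheory.PAdicHodge.fontainePstAdicCompletion w ℓ' hw).IsDeRhamFramed
              (ρ'.toLocal w) :=
        ⟨hρ'.mono fun w ⟨_, _, hur, _⟩ => hur,
          fun w hw => (hP F n hcpt hn π hL ℓ' ι' ρ' hirr' hρ' w hw).1⟩
      exact (hP F n hcpt hn π hL ℓ ι ρ hirr hρ v hv).2 Rec ℓ' ι' ρ' hℓ' hirr' hρ'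
        (hRec n hcpt hn π hL ℓ' ι' ρ' hirr' hgeo' hρ' v hℓ')
    · exact hRec n hcpt hn π hL ℓ ι ρ hirr hgeo hρ v hv
  refine ⟨?_, ?_⟩
  · -- (A) automorphic → Galois, uniqueness up to conjugacy from the proved support item U
    intro π hL ℓ _ ι
    obtain ⟨ρ, hirr, hρ⟩ := hW F n hcpt hn π hL ℓ ι
    obtain ⟨hgeo, hloc⟩ := hLGC π hL ℓ ι ρ hirr hρ
    exact ⟨ρ, hirr, hgeo, ⟨hρ, hloc⟩, fun ρ' h' => hU F n hcpt π ℓ ι ρ ρ' hirr hρ h'.1⟩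
  · -- (B) Galois → automorphic
    intro ℓ _ ι ρ hirr hgeo
    obtain ⟨π, hL, hρ⟩ := hB n F hcpt hn ℓ ι ρ hirr hgeo
    exact ⟨π, hL, hρ, (hLGC π hL ℓ ι ρ hirr hρ).2⟩

end Summit.Langlands.Langlands.Theses.LieTypeCarving
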